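/-
Copyright: literature formalisation for the harness. Statements follow the cited text.
-/
import Literature.AlgebraicGeometry.CossartPiltant200819.PrimaryContraction2008
import Literature.AlgebraicGeometry.CossartPiltant200819.MonomialInversion2008
import HarnessLib

/-!
# [CP-I] Lemma 9.4 / [Fu1997] Prop 3.8 ⇒ Thm 3.6 (1): from the unit-monomial presentation
`wᵢ = δᵢ x^{aᵢ}` straight to "`Q = (m_S ∩ K)S` is `m_S`-primary" — steps (T3) + (T4) COMPOSED in
the kernel, for any ground field and any number `r = n` of parameters

V. Cossart, O. Piltant, *Resolution of singularities of threefolds in positive characteristic I*,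
J. Algebra 320 (2008) 1051–1082 [CossartPiltant2008]; manuscript hal-00139124 ("HAL"), Lemma 9.4
(= journal Lemma 9.2), proof, p. 30 l. 14–16. D. Fu, *Local weak simultaneous resolution for high
rational ranks*, J. Algebra 194 (1997) 614–630 [Fu1997], Prop 3.8 and Thm 3.6 (1), p. 628
(held text [corpus:paper:doi-10-1006-jabr-1996-7014], file `p0015.txt`).

Context (cell pub-hironaka, GAPS §GA rows G7-A21.S, G9-A21.S-R, G13-A21.S-T). The stability
statement (S3\*) used without proof in the printed proof of [CP-I] Lemma 9.4 is repaired in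
`StableModelCriterion2008.lean` / `PrimaryContraction2008.lean` from a PRIMARY CONTRACTION
statement — Fu's Thm 3.6 transported to an arbitrary ground field as the named hypothesis
`CP2008.PrimaryTransformRankOne`, whose docstring proof (T0)–(T5) has two purely algebraic
steps: (T3) "Let `A = (a_{ij})` be the `r × r` matrix with entries `a_{ij}`, and let
`D = |det(A)|`. Since the `ν(wᵢ)` are rationally independent, `D ≠ 0`, and since the taking of
quotients and powers of the `wᵢ` corresponds to ℤ-row operations on `A`, it follows that there are
units `dᵢ ∈ S` such that `x₁^D d₁, …, x_r^D d_r ∈ K ∩ N = M ⊂ Q`." [Fu1997, p. 628, proof of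
Prop 3.8; held text file `p0015.txt` L28–33, verbatim; `M = N ∩ K` in the notation of Thm 3.6],
kernel-checked in `MonomialInversion2008.lean` (`MonomialInversion.dagger_of_monomial_relations`,
any finite index type, with `D ≠ 0` as a HYPOTHESIS `hdet`); and (T4) "Thus `x₁, …, x_r ∈ √Q`, and
so `ht Q ≥ r`." [p. 628, `p0015.txt` L34] together with "Part (1) of Theorem 3.6 follows
immediately from the following [Proposition 3.8]" [p. 628, `p0015.txt` L8–9] — for `r = n` the
radical `√Q` contains the maximal ideal, i.e. `Q` is `N`-primary — kernel-checked for `r = n = 3`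
in `PrimaryContraction2008.lean` (`CP2008.contractedCentrePrimary_of_dagger`, index type `Fin 3`).

This module CLOSES the two remaining seams of that algebraic segment:
* `CP2008.valuation_eq_one_of_mul_eq_one` — a unit of a subring of the valuation ring has value
  `1` [folklore];
* `CP2008.det_ne_zero_of_indepValues` — **the first clause of (T3)**, so far the hypothesis
  `hdet`: if `wᵢ = δᵢ ∏ₗ xₗ^{A i l}` with `δᵢ` units of `S ⊆ W` and the values `W(w₁), …, W(w_r)`
  are ℤ-independent (`∏ wᵢ^{nᵢ}` has value `1` only for `n = 0` — the tree idiom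
  `CP2008.QIndepValues` of Prop 8.1 (2), here for any finite index type), then `det A ≠ 0`
  (a vanishing determinant gives `c ≠ 0` in `ℤ^ι` with `c·A = 0`,
  `Matrix.exists_vecMul_eq_zero_iff`, and then `W(∏ wᵢ^{cᵢ}) = ∏ₗ W(xₗ)^{(c·A)ₗ} = 1`)
  [cite: Fu1997, Prop 3.8 (p. 628; `p0015.txt` L29–30)];
* `CP2008.contractedCentrePrimary_of_dagger_fintype` — (T4) for ANY finite index type `ι`
  (Fu's Thm 3.6 (1) is stated for `r = n`, every `n`; the tree's `contractedCentrePrimary_of_dagger`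
  is, binder for binder, its `ι = Fin 3` instance and is cited, not restated): centre generated by
  `(xᵢ)_{i ∈ ι}` + (†) for every `i` ⇒ `ContractedCentrePrimary` (pigeonhole
  `Ideal.sum_pow_mem_span_pow`, exponent `|ι|·M + 1`) [cite: Fu1997, Thm 3.6 (1) via Prop 3.8
  (p. 628; `p0015.txt` L8–9, L34)];
* `CP2008.contractedCentrePrimary_of_monomial_relations` — **(T3) + (T4) composed**: from the
  output of (T2) (`wᵢ ∈ K`, `wᵢ = δᵢ x^{Aᵢ}` in a `k`-subalgebra `S ⊆ W` of `L` whose centre is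
  generated by the nonzero `xᵢ`, `δᵢ ∈ S^×`, independent values of the `wᵢ`) to
  `ContractedCentrePrimary K W S`, any field `k`, any characteristic, any finite `ι`
  [cite: Fu1997, Prop 3.8 and Thm 3.6 (1) (p. 628)], [cite: CossartPiltant2008, Lemma 9.4
  (HAL p. 30 l. 14–16)];
* `CP2008.contractedCentrePrimary_of_monomial_relations_fin_three` — the same for `ι = Fin 3`
  THROUGH THE TREE's `contractedCentrePrimary_of_dagger` and with the independence hypothesis
  literally `QIndepValues W (algebraMap K L ∘ w)` (the shape delivered by Prop 8.1 (2) /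
  `MonomialUniformization` and by (T0)): the check, asked for in the cell's HANDOFF (gen 14 (n1′)),
  that the conclusion of `dagger_of_monomial_relations` is literally the binder `hdag`.

Dimension audit (cell OBSTRUCTIONS-DIM4): every statement here is free of the dimension, of the
characteristic and of any hypothesis on `k`; what is three-dimensional in the use [CP-I] makes of
it is only `r = n = 3` (rational rank = dimension, the case `e = l` of Lemma 9.4 with `rat.rk = 3`)
— for `r = n − 1` the descent (T5) is needed instead, prose in `PrimaryContraction2008.lean`, and
for `r ≤ n − 2` nothing is claimed (the residual (S3\*) `rat.rk W = 1`,
`CP2008.GStableUniformizationInertialRankOne`, is open in print).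

NOTHING here asserts or refutes a statement of [CossartPiltant2008]; Lemma 9.4 remains the cited
named fact `CP2008.TamePrimeDescent`. No `sorry`, no new definition, no `Summits` import.
-/

namespace Literature.AlgebraicGeometry.CossartPiltant200819.CP2008

open Literature.AlgebraicGeometry.Resolution Matrix Finset

universe u

section Units

variable {L : Type u} [Field L]

/-- A unit of a subring `S ⊆ W` of a valuation ring has value `1`: `W(δ) ≤ 1`, `W(δ') ≤ 1` and
`W(δ)W(δ') = W(1) = 1`. [folklore] -/
theorem valuation_eq_one_of_mul_eq_one (W : ValuationSubring L) {δ δ' : L} (hδ : δ ∈ W)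
    (hδ' : δ' ∈ W) (h : δ * δ' = 1) : W.valuation δ = 1 := by
  have h1 : W.valuation δ ≤ 1 := (W.valuation_le_one_iff _).mpr hδ
  have h2 : W.valuation δ' ≤ 1 := (W.valuation_le_one_iff _).mpr hδ'
  have h12 : W.valuation δ * W.valuation δ' = 1 := by rw [← map_mul, h, map_one]
  refine le_antisymm h1 ?_
  calc (1 : _) = W.valuation δ * W.valuation δ' := h12.symm
    _ ≤ W.valuation δ * 1 := mul_le_mul' le_rfl h2
    _ = W.valuation δ := mul_one _

end Units

section Determinant

variable {K L : Type u} [Field K] [Field L] [Algebra K L]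
variable {ι : Type*} [Fintype ι] [DecidableEq ι]

/-- **(T3), first clause** [Fu1997, Prop 3.8, p. 628 (held text `p0015.txt` L29–30): "Since the
`ν(wᵢ)` are rationally independent, `D ≠ 0`"], PROVED for any finite index type: if
`wᵢ = δᵢ ∏ₗ xₗ^{A i l}` in `L` with
`W(δᵢ) = 1` and the values of the `wᵢ` are ℤ-independent (`W(∏ᵢ wᵢ^{nᵢ}) = 1 ⇒ n = 0`, the
idiom of `CP2008.QIndepValues`), then `det A ≠ 0` (as an integer matrix). Proof: if `det A = 0`,
`Matrix.exists_vecMul_eq_zero_iff` (ℤ a domain) gives `c ≠ 0` with `c ᵥ* A = 0`, and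
`W(∏ᵢ wᵢ^{cᵢ}) = ∏ᵢ W(δᵢ)^{cᵢ} · ∏ₗ W(xₗ)^{Σᵢ cᵢ A i l} = 1`. [cite: Fu1997, Prop 3.8 (p. 628)] -/
theorem det_ne_zero_of_indepValues (W : ValuationSubring L) (x δ w : ι → L) (hx : ∀ l, x l ≠ 0)
    (hδ : ∀ i, W.valuation (δ i) = 1) (A : Matrix ι ι ℕ)
    (hrel : ∀ i, w i = δ i * ∏ l, x l ^ A i l)
    (hind : ∀ n : ι → ℤ, W.valuation (∏ i, w i ^ n i) = 1 → n = 0) :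
    (A.map (Nat.cast : ℕ → ℤ)).det ≠ 0 := by
  set Az : Matrix ι ι ℤ := A.map (Nat.cast : ℕ → ℤ) with hAz
  intro hdet
  obtain ⟨c, hc0, hcA⟩ := Matrix.exists_vecMul_eq_zero_iff.mpr hdet
  apply hc0
  apply hind c
  -- `∏ᵢ wᵢ^{cᵢ} = (∏ᵢ δᵢ^{cᵢ}) · ∏ₗ xₗ^{(c ᵥ* Az) l}`
  have hδ0 : ∀ i, δ i ≠ 0 := fun i h => by
    have := hδ i; rw [h, map_zero] at this; exact zero_ne_one this
  have hentry : ∀ l, (∑ i, c i * (A i l : ℤ)) = (c ᵥ* Az) l := by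
    intro l
    rw [Matrix.vecMul, dotProduct]
    refine Finset.sum_congr rfl fun i _ => ?_
    rw [hAz, Matrix.map_apply]
  have hprod : ∏ i, w i ^ c i = (∏ i, δ i ^ c i) * ∏ l, x l ^ (c ᵥ* Az) l := by
    calc ∏ i, w i ^ c i = ∏ i, (δ i ^ c i * ∏ l, x l ^ ((A i l : ℤ) * c i)) := by
          refine Finset.prod_congr rfl fun i _ => ?_
          rw [hrel i, mul_zpow, ← Finset.prod_zpow]
          congr 1
          refine Finset.prod_congr rfl fun l _ => ?_
          rw [← zpow_natCast, ← _root_.zpow_mul]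
      _ = (∏ i, δ i ^ c i) * ∏ i, ∏ l, x l ^ ((A i l : ℤ) * c i) := Finset.prod_mul_distrib
      _ = (∏ i, δ i ^ c i) * ∏ l, x l ^ (∑ i, (A i l : ℤ) * c i) := by
          rw [Finset.prod_comm]
          congr 1
          exact Finset.prod_congr rfl fun l _ =>
            (MonomialInversion.zpow_finset_sum₀ (hx l) _ _).symm
      _ = (∏ i, δ i ^ c i) * ∏ l, x l ^ (c ᵥ* Az) l := by
          congr 1
          refine Finset.prod_congr rfl fun l _ => ?_
          rw [← hentry l]
          congr 1
          exact Finset.sum_congr rfl fun i _ => mul_comm _ _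
  rw [hprod, map_mul, map_prod, map_prod]
  simp_rw [map_zpow₀, hδ, _root_.one_zpow, Finset.prod_const_one, one_mul]
  refine Finset.prod_eq_one fun l _ => ?_
  rw [hcA, Pi.zero_apply, zpow_zero]

end Determinant

section Primary

variable {k : Type u} [Field k] (K : Type u) {L : Type u} [Field K] [Field L] [Algebra K L]
  [Algebra k L]

/-- **[Fu1997] Thm 3.6 (1) from Prop 3.8, case `r = n`, ANY `n`** (p. 628, held text `p0015.txt`
L34: "Thus `x₁, …, x_r ∈ √Q`, and so `ht Q ≥ r`." and L8–9: "Part (1) of Theorem 3.6 follows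
immediately from the following [Proposition 3.8]"), PROVED in the elementwise idiom of
`ContractedCentrePrimary` for ANY ground field and ANY finite index type `ι` (the tree's
`contractedCentrePrimary_of_dagger` is the instance `ι = Fin 3`): if `S ⊆ W` is a `k`-subalgebra
of `L` whose centre `N = {s ∈ S : W(s) > 0}` is generated by `(xᵢ)_{i ∈ ι} ⊆ N`, and for each `i`
some `xᵢ^D · δ` (`D ≥ 1`, `δ ∈ S^×`) lies in `K` (the relations (†)), then every element of `N` has
a power in `Q = (N ∩ K)S`. Pigeonhole on monomials: `(Σᵢ aᵢxᵢ)^{|ι|·M + 1} ∈ (xᵢ^{M+1} : i)S`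
(`Ideal.sum_pow_mem_span_pow`), `M = Σᵢ Dᵢ`. Dimension-free, characteristic-free.
[cite: Fu1997, Thm 3.6 (1) and Prop 3.8 (p. 628)] -/
theorem contractedCentrePrimary_of_dagger_fintype {ι : Type*} [Fintype ι]
    (W : ValuationSubring L) (S : Subalgebra k L)
    (hSW : ∀ s ∈ S, s ∈ W) (x : ι → L) (hxS : ∀ i, x i ∈ S)
    (hxv : ∀ i, W.valuation (x i) < 1)
    (hgen : ∀ s ∈ S, W.valuation s < 1 → ∃ a : ι → L, (∀ i, a i ∈ S) ∧ s = ∑ i, a i * x i)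
    (hdag : ∀ j, ∃ D : ℕ, 0 < D ∧ ∃ δ ∈ S, (∃ δ' ∈ S, δ * δ' = 1) ∧
      x j ^ D * δ ∈ Set.range (algebraMap K L)) :
    ContractedCentrePrimary K W S := by
  classical
  intro s hs
  set Q : Ideal S := Ideal.span {y : S | (y : L) ∈ Set.range (algebraMap K L) ∧
      W.valuation (y : L) < 1} with hQ
  let x' : ι → S := fun i => ⟨x i, hxS i⟩
  -- (†) puts a power of each parameter in `Q`
  have hxQ : ∀ j, ∃ D : ℕ, x' j ^ D ∈ Q := by
    intro j
    obtain ⟨D, hD, δ, hδS, ⟨δ', hδ'S, hδδ'⟩, hK⟩ := hdag j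
    obtain ⟨D₀, rfl⟩ := Nat.exists_eq_succ_of_ne_zero hD.ne'
    refine ⟨D₀ + 1, ?_⟩
    have hmS : x j ^ D₀ * δ ∈ S := S.mul_mem (S.pow_mem (hxS j) D₀) hδS
    have hyS : x j ^ (D₀ + 1) * δ ∈ S := S.mul_mem (S.pow_mem (hxS j) _) hδS
    have hyv : W.valuation (x j ^ (D₀ + 1) * δ) < 1 := by
      have hle : W.valuation (x j ^ D₀ * δ) ≤ 1 := (W.valuation_le_one_iff _).mpr (hSW _ hmS)
      have heq : x j ^ (D₀ + 1) * δ = x j * (x j ^ D₀ * δ) := by ring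
      rw [heq, map_mul]
      calc W.valuation (x j) * W.valuation (x j ^ D₀ * δ)
          ≤ W.valuation (x j) * 1 := mul_le_mul' le_rfl hle
        _ < 1 := by rw [mul_one]; exact hxv j
    have hy : (⟨x j ^ (D₀ + 1) * δ, hyS⟩ : S) ∈ Q := Ideal.subset_span ⟨hK, hyv⟩
    have hfac : x' j ^ (D₀ + 1) = ⟨x j ^ (D₀ + 1) * δ, hyS⟩ * ⟨δ', hδ'S⟩ := by
      apply Subtype.ext
      simp only [x', SubmonoidClass.mk_pow, Subalgebra.coe_mul]
      rw [mul_assoc, hδδ', mul_one]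
    rw [hfac]
    exact Q.mul_mem_right _ hy
  choose D hDQ using hxQ
  -- a common exponent `M`
  set M : ℕ := ∑ i, D i with hM
  have hDle : ∀ i, D i ≤ M := fun i =>
    Finset.single_le_sum (f := D) (fun j _ => Nat.zero_le _) (Finset.mem_univ i)
  have hxM : ∀ i, x' i ^ (M + 1) ∈ Q := fun i => by
    have h := Q.mul_mem_right (x' i ^ (M + 1 - D i)) (hDQ i)
    rwa [← pow_add, Nat.add_sub_cancel' ((hDle i).trans (Nat.le_succ M))] at h
  -- write `s = Σ aᵢ xᵢ` in `S`
  obtain ⟨a, haS, hsum⟩ := hgen s s.2 hs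
  let a' : ι → S := fun i => ⟨a i, haS i⟩
  have hs' : s = ∑ i, a' i * x' i := by
    apply Subtype.ext
    rw [hsum]
    simp only [a', x', AddSubmonoidClass.coe_finsetSum, Subalgebra.coe_mul]
  -- pigeonhole on monomials
  refine ⟨(Finset.univ : Finset ι).card * M + 1, ?_⟩
  have hmem := Ideal.sum_pow_mem_span_pow (Finset.univ : Finset ι) (fun i => a' i * x' i) M
  rw [hs']
  refine (Ideal.span_le.mpr ?_) hmem
  rintro _ ⟨i, -, rfl⟩
  show (a' i * x' i) ^ (M + 1) ∈ Q
  rw [mul_pow]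
  exact Q.mul_mem_left _ (hxM i)

-- (The instance `ι = Fin 3` of `contractedCentrePrimary_of_dagger_fintype` is, binder for
-- binder, the tree's `contractedCentrePrimary_of_dagger` of `PrimaryContraction2008.lean`; it is not
-- restated here — cite that declaration.)

variable {ι : Type*} [Fintype ι] [DecidableEq ι]

/-- **(T3) + (T4) composed — [Fu1997] Prop 3.8 ⇒ Thm 3.6 (1) for `r = n`, any `n`, any ground
field** [Fu1997, p. 628, proof of Prop 3.8 (`p0015.txt` L21–34); used at [CP-I] HAL p. 30
l. 14–16 through the transport `PrimaryTransformRankOne`]: let `S ⊆ W` be a `k`-subalgebra of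
`L` whose centre is generated by nonzero `x : ι → L` of positive value (the output r.s.p. of
(T1)/(T2)), and let `wᵢ ∈ K` satisfy `wᵢ = δᵢ ∏ₗ xₗ^{A i l}` in `L` with `δᵢ` units of `S` (the
display of (T2)) and have ℤ-independent values (the choice of (T0)). Then `Q = (m_S ∩ K)S` is
`m_S`-primary (`ContractedCentrePrimary K W S`). Proof = `det_ne_zero_of_indepValues` (first
clause of (T3)) + `MonomialInversion.dagger_of_monomial_relations` ((†),
`MonomialInversion2008.lean`) + `contractedCentrePrimary_of_dagger_fintype` ((T4)). No hypothesis
on `k`, the characteristic or `|ι|`. [cite: Fu1997, Prop 3.8 and Thm 3.6 (1) (p. 628)]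
[cite: CossartPiltant2008, Lemma 9.4 (HAL p. 30 l. 14–16)] -/
theorem contractedCentrePrimary_of_monomial_relations (W : ValuationSubring L)
    (S : Subalgebra k L) (hSW : ∀ s ∈ S, s ∈ W) (x : ι → L) (hxS : ∀ i, x i ∈ S)
    (hx0 : ∀ i, x i ≠ 0) (hxv : ∀ i, W.valuation (x i) < 1)
    (hgen : ∀ s ∈ S, W.valuation s < 1 → ∃ a : ι → L, (∀ i, a i ∈ S) ∧ s = ∑ i, a i * x i)
    (δ : ι → L) (hδS : ∀ i, δ i ∈ S) (hδu : ∀ i, ∃ δ' ∈ S, δ i * δ' = 1)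
    (w : ι → K) (A : Matrix ι ι ℕ)
    (hrel : ∀ i, algebraMap K L (w i) = δ i * ∏ l, x l ^ A i l)
    (hind : ∀ n : ι → ℤ, W.valuation (∏ i, algebraMap K L (w i) ^ n i) = 1 → n = 0) :
    ContractedCentrePrimary K W S := by
  have hδv : ∀ i, W.valuation (δ i) = 1 := fun i => by
    obtain ⟨δ', hδ'S, h1⟩ := hδu i
    exact valuation_eq_one_of_mul_eq_one W (hSW _ (hδS i)) (hSW _ hδ'S) h1
  have hdet : (A.map (Nat.cast : ℕ → ℤ)).det ≠ 0 :=
    det_ne_zero_of_indepValues W x δ (fun i => algebraMap K L (w i)) hx0 hδv A hrel hind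
  exact contractedCentrePrimary_of_dagger_fintype K W S hSW x hxS hxv hgen
    (fun j => MonomialInversion.dagger_of_monomial_relations S x hx0 δ hδS hδu w A hrel hdet j)

/-- **The `ι = Fin 3` case THROUGH THE TREE's (T4)** (`contractedCentrePrimary_of_dagger`, whose
binder `hdag` is literally the conclusion of `MonomialInversion.dagger_of_monomial_relations`),
with the independence hypothesis in the tree idiom `QIndepValues W (algebraMap K L ∘ w)` of
Prop 8.1 (2) / `MonomialUniformization`: this is the statement consumed at [CP-I] HAL p. 30
l. 14–16 in the case `e = l`, `rat.rk W = 3` of Lemma 9.4 (three parameters, three `wᵢ`).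
[cite: CossartPiltant2008, Lemma 9.4 (HAL p. 30 l. 14–16) and Prop 8.1 (2) (HAL p. 22)]
[cite: Fu1997, Prop 3.8 and Thm 3.6 (1) (p. 628)] -/
theorem contractedCentrePrimary_of_monomial_relations_fin_three (W : ValuationSubring L)
    (S : Subalgebra k L) (hSW : ∀ s ∈ S, s ∈ W) (x : Fin 3 → L) (hxS : ∀ i, x i ∈ S)
    (hx0 : ∀ i, x i ≠ 0) (hxv : ∀ i, W.valuation (x i) < 1)
    (hgen : ∀ s ∈ S, W.valuation s < 1 → ∃ a : Fin 3 → L, (∀ i, a i ∈ S) ∧ s = ∑ i, a i * x i)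
    (δ : Fin 3 → L) (hδS : ∀ i, δ i ∈ S) (hδu : ∀ i, ∃ δ' ∈ S, δ i * δ' = 1)
    (w : Fin 3 → K) (A : Matrix (Fin 3) (Fin 3) ℕ)
    (hrel : ∀ i, algebraMap K L (w i) = δ i * ∏ l, x l ^ A i l)
    (hind : QIndepValues W (fun i => algebraMap K L (w i))) :
    ContractedCentrePrimary K W S := by
  have hδv : ∀ i, W.valuation (δ i) = 1 := fun i => by
    obtain ⟨δ', hδ'S, h1⟩ := hδu i
    exact valuation_eq_one_of_mul_eq_one W (hSW _ (hδS i)) (hSW _ hδ'S) h1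
  have hdet : (A.map (Nat.cast : ℕ → ℤ)).det ≠ 0 :=
    det_ne_zero_of_indepValues W x δ (fun i => algebraMap K L (w i)) hx0 hδv A hrel hind.2
  exact contractedCentrePrimary_of_dagger K W S hSW x hxS hxv hgen
    (fun j => MonomialInversion.dagger_of_monomial_relations S x hx0 δ hδS hδu w A hrel hdet j)

end Primary

end Literature.AlgebraicGeometry.CossartPiltant200819.CP2008
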